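import Literature.NumberTheory.Automorphic.DiscreteAutomorphicRepFinAdelicScalar     -- ★ brings `exists_finset_forall_mem_of_nhds_one` (cofinite boxes), `inclPlaceAdelic`, `archToAdelic_mul_finAdelicToAdelic`, `evalPlace`∕`inclPlace` algebra
import Literature.NumberTheory.Automorphic.UnitaryGroupPureTensorContinuity         -- ★ `localPiEquiv_evalPlace_finPart` (`g_v` is the `v`-component of `g_f`)
import HarnessLib

/-!
# R90-TF · S10 (Rogawski 1990 §13.8) · THEOREMS — `R90S10AutCharUnramifiedSplit`: a continuous character of `U(J)(𝔸_F)` UNRAMIFIED OFF ONE PLACE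
# SPLITS as `χ(g) = χ(g_∞) · χ_v(g_v)` on the unramified box (lemma (F) of the θ-line's global trace pin `hθi`)

Cell hodgecm-mathlib, slab R90-TF, section S10 = §13.8, crux item h413 = stmt-HodgeConjecture-24833 (route `route-HodgeConjecture-HCCMUnconditional`).  Prover seat
R90-C138-p05 (g0), DEAL #40b step (C-iii-2) (census `CENSUS-40b-thetaLineGlobal.md` d666bc68, RULING J-θ (β′)): the one non-bookkeeping step of the θ-line's trace pin `hθi` of ★
`S10HDatum` — for a continuous character `χ` of the adelic unitary group `U(J)(𝔸_F)` (generic datum ★ `UnitaryGroup.adelicGroupData F E c N J`) whose local components are TRIVIAL on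
the integral levels `U(J)(𝒪_w)` at every finite `w ≠ v`, and every `g` whose components off `v` are integral: `χ(g) = χ((g_∞, 1)) · χ(ι_v(g_v))` — the finite-adelic part of `χ` sees
only the `v`-component.  With the local components read in the ★ `cmDatum` model (`θloc w ∘ localPiEquiv w = χ ∘ inclPlaceAdelic w`) this is `χ(g) = χ(g_∞) · θloc v (toLocal v g)`.

PRINT → PROOF ([TateThesis1967, Ch. XV §3.2 Lemma 3.2.1 (proof)]; [BorelJacquet1979, §4.1]; [Flath1979, §2]; Rogawski §13.8 p. 219 L1–2 reads `θ` through `Tr θ(Φ) = m(θ)·∫ g_∞ θ_∞ · Tr θ_v(g_v)`,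
which needs exactly this splitting).  (F0) If `d ∈ U(J)(𝔸_{F,f})` has every component integral and in the kernel of `χ ∘ ι_w`, then `χ((1, d)) = 1`: for `ε > 0` the set
`U = {k : |χ((1,k)) − 1| < ε}` is a neighbourhood of `1`, so contains a cofinite box `∏_{w ∉ T} U(J)(𝒪_w) × ∏_{w ∈ T} {1}` (★ `exists_finset_forall_mem_of_nhds_one`, transported along ★
`finAdelicEquiv`); peeling the finitely many coordinates `w ∈ T` off `d` one at a time (★ `exists_eq_mul_inclPlace`; each peeled factor `ι_w(d_w)` lies in the kernel) leaves an element
of the box with the same value of `χ`, whence `|χ((1,d)) − 1| < ε` for every `ε`.  (F) Then `g = (g_∞, 1) · (1, g_f)` (★ `archToAdelic_mul_finAdelicToAdelic`), `g_f = g′_f · ι_v(g_v)` with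
`g′_f` integral everywhere and `(g′_f)_v = 1` (★ `exists_eq_mul_inclPlace`), and (F0) kills `χ((1, g′_f))`.

CONTENTS (theorems only; no `def`, no `instance`, no `notation`, no `sorry`; axioms ⊆ {propext, Classical.choice, Quot.sound}).
* `apply_finAdelicToAdelic_eq_one_of_forall_evalPlace` — (F0).
* `apply_eq_apply_archToAdelic_mul_apply_inclPlaceAdelic_of_unramified` — (F), generic datum.
* `apply_eq_apply_archToAdelic_mul_local_of_unramified` — (F) with the `v`-component read in the ★ `cmDatum` model through a local character `θv` (`θv ∘ localPiEquiv v = χ ∘ ι_v`):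
  `χ g = χ (archToAdelic (archPart g)) * θv ((adelicGroupData …).toLocal v g)`.

HONEST LABEL: generic lemma; pays no socket; HC_CM is proved only modulo the 7 printed citations (2 remaining named inputs: hLiu418 = stmt-HodgeConjecture-24832, h413 =
stmt-HodgeConjecture-24833) until rung 0 closes; count-neutral helper; REL ≠ ★ ≠ BUILT.  Namespace `Summit.HodgeConjecture.HodgeConjecture.R90.S10`.

## References
* [TateThesis1967] J. Tate, *Fourier analysis in number fields and Hecke's zeta-functions*, in Cassels–Fröhlich, *Algebraic Number Theory* (1967), Ch. XV §3.2, Lemma 3.2.1.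
* [BorelJacquet1979] A. Borel, H. Jacquet, *Automorphic forms and automorphic representations*, PSPM 33.1 (1979), §4.1.
* [Flath1979] D. Flath, *Decomposition of representations into tensor products*, PSPM 33.1 (1979), §2.
* [Rogawski1990] J. D. Rogawski, *Automorphic Representations of Unitary Groups in Three Variables*, Ann. of Math. Stud. 123 (1990), §13.8 p. 219 L1–2.
-/

set_option autoImplicit false
-- the mandated namespace repeats the single-problem summit's segment (`HodgeConjecture.HodgeConjecture`)
set_option linter.dupNamespace false

noncomputable section

open NumberField IsDedekindDomain Topology Filter
open scoped RestrictedProduct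
open Literature.NumberTheory.Automorphic Literature.NumberTheory.Automorphic.UnitaryGroup

namespace Summit.HodgeConjecture.HodgeConjecture.R90.S10

section Generic

variable {F E : Type} [Field F] [NumberField F] [Field E] [NumberField E] [Algebra F E]
  {c : E ≃ₐ[F] E} {N : ℕ} {J : Matrix (Fin N) (Fin N) E}

/-- **(F0) A CONTINUOUS CHARACTER IS TRIVIAL ON AN INTEGRAL FINITE IDELE WHOSE COMPONENTS LIE IN THE LOCAL KERNELS.**  If `d ∈ U(J)(𝔸_{F,f})` has `d_w ∈ U(J)(𝒪_w)` and
`χ(ι_w(d_w)) = 1` for EVERY finite `w`, then `χ((1, d)) = 1`: neighbourhoods of `1` contain cofinite boxes (★ `exists_finset_forall_mem_of_nhds_one`), and the finitely many remaining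
coordinates are peeled off inside the kernel (★ `exists_eq_mul_inclPlace`). [cite: TateThesis1967, Ch. XV §3.2, Lemma 3.2.1 (proof)] [cite: BorelJacquet1979, §4.1] -/
theorem apply_finAdelicToAdelic_eq_one_of_forall_evalPlace (χ : (adelicGroupData F E c N J).Adelic →* ℂˣ) (hχ : Continuous fun g => ((χ g : ℂˣ) : ℂ))
    (d : finAdelic F E c N J) (hint : ∀ w : HeightOneSpectrum (𝓞 F), evalPlace F E c N J w d ∈ localInt E c N J w)
    (hker : ∀ w : HeightOneSpectrum (𝓞 F), χ (inclPlaceAdelic F E c N J w (evalPlace F E c N J w d)) = 1) :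
    χ (finAdelicToAdelic F E c N J d) = 1 := by
  classical
  -- peeling finitely many coordinates off `d` inside the kernel
  have peel : ∀ T : Finset (HeightOneSpectrum (𝓞 F)), ∃ e : finAdelic F E c N J,
      (∀ w ∈ T, evalPlace F E c N J w e = 1) ∧ (∀ w ∉ T, evalPlace F E c N J w e = evalPlace F E c N J w d) ∧
        χ (finAdelicToAdelic F E c N J d) = χ (finAdelicToAdelic F E c N J e) := by
    intro T
    induction T using Finset.induction_on with
    | empty => exact ⟨d, fun w hw => absurd hw (Finset.notMem_empty w), fun w _ => rfl, rfl⟩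
    | insert w₀ T hw₀ ih =>
      obtain ⟨e, he1, he2, he3⟩ := ih
      obtain ⟨e', he'1, he'2, he'3⟩ := exists_eq_mul_inclPlace F E c N J w₀ e
      refine ⟨e', fun w hw => ?_, fun w hw => ?_, ?_⟩
      · rcases Finset.mem_insert.1 hw with rfl | hwT
        · exact he'1
        · have hne : w ≠ w₀ := fun h => hw₀ (h ▸ hwT)
          rw [he'2 w hne, he1 w hwT]
      · have hne : w ≠ w₀ := fun h => hw (h ▸ Finset.mem_insert_self w₀ T)
        have hwT : w ∉ T := fun h => hw (Finset.mem_insert_of_mem h)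
        rw [he'2 w hne, he2 w hwT]
      · have hw₀d : evalPlace F E c N J w₀ e = evalPlace F E c N J w₀ d := he2 w₀ hw₀
        rw [he3, he'3, map_mul, map_mul, hw₀d, ← inclPlaceAdelic_apply, hker w₀, mul_one]
  -- `|χ((1,d)) - 1| < ε` for every `ε > 0`
  have key : ∀ ε : ℝ, 0 < ε → ‖((χ (finAdelicToAdelic F E c N J d) : ℂˣ) : ℂ) - 1‖ < ε := by
    intro ε hε
    set U : Set (finAdelic F E c N J) := {k | ‖((χ (finAdelicToAdelic F E c N J k) : ℂˣ) : ℂ) - 1‖ < ε} with hUdef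
    have hUo : IsOpen U :=
      isOpen_lt ((hχ.comp (continuous_finAdelicToAdelic F E c N J)).sub continuous_const).norm continuous_const
    have hU1 : (1 : finAdelic F E c N J) ∈ U := by
      show ‖((χ (finAdelicToAdelic F E c N J 1) : ℂˣ) : ℂ) - 1‖ < ε
      rw [map_one, map_one, Units.val_one, sub_self, norm_zero]
      exact hε
    have hU : U ∈ 𝓝 (1 : finAdelic F E c N J) := hUo.mem_nhds hU1
    have hU' : (finAdelicEquiv F E c N J).symm ⁻¹' U ∈
        𝓝 (1 : Πʳ v : HeightOneSpectrum (𝓞 F), [localPi E c N J v, localInt E c N J v]) := by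
      refine (finAdelicEquiv F E c N J).symm.continuous.continuousAt.preimage_mem_nhds ?_
      change U ∈ 𝓝 ((finAdelicEquiv F E c N J).symm 1)
      rwa [map_one]
    obtain ⟨T, hT⟩ := Literature.Topology.Algebra.RestrictedProduct.exists_finset_forall_mem_of_nhds_one
      (B := fun v : HeightOneSpectrum (𝓞 F) => localInt E c N J v) (fun v => isOpen_localInt E c N J v) hU'
    obtain ⟨e, he1, he2, he3⟩ := peel T
    have heU : e ∈ U := by
      have h := hT (finAdelicEquiv F E c N J e) (fun w => ?_) (fun w hw => ?_)
      · simpa using h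
      · change evalPlace F E c N J w e ∈ localInt E c N J w
        by_cases hw : w ∈ T
        · rw [he1 w hw]; exact one_mem _
        · rw [he2 w hw]; exact hint w
      · change evalPlace F E c N J w e = 1
        exact he1 w hw
    rw [he3]
    exact heU
  have h1 : ((χ (finAdelicToAdelic F E c N J d) : ℂˣ) : ℂ) = 1 := by
    by_contra hne
    exact lt_irrefl _ (key _ (norm_pos_iff.2 (sub_ne_zero.2 hne)))
  exact Units.val_eq_one.1 h1

/-- **(F) A CHARACTER UNRAMIFIED OFF `v` SPLITS ON THE UNRAMIFIED BOX: `χ(g) = χ((g_∞, 1)) · χ(ι_v(g_v))`** whenever `g_w ∈ U(J)(𝒪_w)` for every finite `w ≠ v` and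
`χ ∘ ι_w` is trivial on `U(J)(𝒪_w)` for every finite `w ≠ v` (★ `archToAdelic_mul_finAdelicToAdelic`, ★ `exists_eq_mul_inclPlace`, (F0)).
[cite: BorelJacquet1979, §4.1] [cite: Flath1979, §2] [cite: TateThesis1967, Ch. XV §3.2] -/
theorem apply_eq_apply_archToAdelic_mul_apply_inclPlaceAdelic_of_unramified
    (χ : (adelicGroupData F E c N J).Adelic →* ℂˣ) (hχ : Continuous fun g => ((χ g : ℂˣ) : ℂ)) (v : HeightOneSpectrum (𝓞 F))
    (hunr : ∀ w : HeightOneSpectrum (𝓞 F), w ≠ v → ∀ u : localPi E c N J w, u ∈ localInt E c N J w → χ (inclPlaceAdelic F E c N J w u) = 1)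
    (g : (adelicGroupData F E c N J).Adelic)
    (hg : ∀ w : HeightOneSpectrum (𝓞 F), w ≠ v → evalPlace F E c N J w (finPart F E c N J g) ∈ localInt E c N J w) :
    χ g = χ (archToAdelic F E c N J (archPart F E c N J g)) *
      χ (inclPlaceAdelic F E c N J v (evalPlace F E c N J v (finPart F E c N J g))) := by
  obtain ⟨b', hb'1, hb'2, hb'3⟩ := exists_eq_mul_inclPlace F E c N J v (finPart F E c N J g)
  have h0 : χ (finAdelicToAdelic F E c N J b') = 1 := by
    refine apply_finAdelicToAdelic_eq_one_of_forall_evalPlace χ hχ b' (fun w => ?_) (fun w => ?_)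
    · by_cases hw : w = v
      · subst hw; rw [hb'1]; exact one_mem _
      · rw [hb'2 w hw]; exact hg w hw
    · by_cases hw : w = v
      · subst hw; rw [hb'1, map_one, map_one]
      · rw [hb'2 w hw]; exact hunr w hw _ (hg w hw)
  conv_lhs => rw [← archToAdelic_mul_finAdelicToAdelic F E c N J g, hb'3]
  rw [map_mul, map_mul, map_mul, h0, one_mul, ← inclPlaceAdelic_apply]

/-- **(F), LOCAL READING: `χ(g) = χ(g_∞) · θv(g_v)`** with the `v`-component read in the ★ `cmDatum` model through a local character `θv : U(J)(F_v) →* ℂˣ` with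
`θv (localPiEquiv v u) = χ (ι_v u)` (★ `localPiEquiv_evalPlace_finPart`: `localPiEquiv v ((g_f)_v) = toLocal v g`).  The shape the θ-line's trace pin `hθi` consumes.
[cite: BorelJacquet1979, §4.1] [cite: Rogawski1990, §13.8 p. 219 L1–2] -/
theorem apply_eq_apply_archToAdelic_mul_local_of_unramified
    (χ : (adelicGroupData F E c N J).Adelic →* ℂˣ) (hχ : Continuous fun g => ((χ g : ℂˣ) : ℂ)) (v : HeightOneSpectrum (𝓞 F))
    (θv : (adelicGroupData F E c N J).Local v →* ℂˣ)
    (hθv : ∀ u : localPi E c N J v, θv (localPiEquiv E c N J v u) = χ (inclPlaceAdelic F E c N J v u))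
    (hunr : ∀ w : HeightOneSpectrum (𝓞 F), w ≠ v → ∀ u : localPi E c N J w, u ∈ localInt E c N J w → χ (inclPlaceAdelic F E c N J w u) = 1)
    (g : (adelicGroupData F E c N J).Adelic)
    (hg : ∀ w : HeightOneSpectrum (𝓞 F), w ≠ v → evalPlace F E c N J w (finPart F E c N J g) ∈ localInt E c N J w) :
    χ g = χ (archToAdelic F E c N J (archPart F E c N J g)) * θv ((adelicGroupData F E c N J).toLocal v g) := by
  rw [apply_eq_apply_archToAdelic_mul_apply_inclPlaceAdelic_of_unramified χ hχ v hunr g hg, ← hθv, localPiEquiv_evalPlace_finPart]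
  rfl

end Generic

end Summit.HodgeConjecture.HodgeConjecture.R90.S10

end
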